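import Summits.BirchSwinnertonDyer.BirchSwinnertonDyer.Theorems.ByReductionTypeAtTwoMultTransportArchLine
import HarnessLib

/-!
# Real halving in `E(ℚ_w)` for every elliptic `E/ℚ` with `Δ_E > 0` (no rational `2`-torsion point
# needed): the real-algebra input of TRUE = DATUM at the real place for `p = 2`

Cell `bsd-f1-sign2`, WIDTH-5 attach seat `bsd-line-att-p4` (gen 3) on line `birth` of crux C2
stmt-BirchSwinnertonDyer-22298 `MainConjectureOfRankZeroBSDAtTwo` (route `AlignedTransportAtTwo`); a
`--supports 22298 --as helper` file (consumer: `…FineRoadLocalArch`). HONEST FRAMING: theorems only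
(no `def`, no named fact, nothing booked); BSD is not proved by any of this.

Cell `bsd-2adic`'s seat t42 proved TRUE = DATUM at the real place for `p = 2`
(`MultTransportAtTwo.localKerOver_two_eq_ker_res_of_realHalving`) from two inputs — a point
`T₃ = (e₃, ·)` of order `2` in `E(ℚ_w)` and REAL HALVING `P = 2ᵏQ` or `2ᵏQ + T₃` — which it supplied
(`exists_ordered_splitTwoTorsion_completion`) only for curves WITH a rational point of order `2`. The
seed cell of crux C2 has none (`S₃`-image). Here the two inputs are produced for EVERY `E/ℚ` with
`Δ_E > 0`:

* §1 `exists_real_root_twoDivisionCubic` — `4x³ + b₂x² + 2b₄x + b₆` has a real root (intermediate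
  value theorem on `[−A, A]`, `A = 1 + |b₂| + |b₄| + |b₆|`).
* §2 **`exists_realTwoTorsion_halving`** — for `Δ_E > 0`: `e₃ ∈ ℚ_w` (the least real root) with
  `T₃ = (e₃, −(a₁e₃ + a₃)/2) ∈ E(ℚ_w)` nonsingular and every `P ∈ E(ℚ_w)` equal to `2ᵏQ` or `2ᵏQ + T₃`
  (t42's `exists_ordered_splitTwoTorsion_real` + `exists_pow_smul_eq_or` over `ℝ`, transported along
  `E(ℚ_w) ≅ E(ℝ)` verbatim as in `exists_ordered_splitTwoTorsion_completion`).

References: J. S. Milne, *ADT* I Rem. 3.7 (`E(ℝ)/2E(ℝ)`); J. H. Silverman, *AEC* III.1, Prop. X.1.4;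
R. Greenberg, LNM 1716 (1999) §5 Remark p. 174.
-/

set_option autoImplicit false
-- sibling precedent (`…FineRoadLocalAway.lean`): the directory name repeats the summit name
set_option linter.dupNamespace false

noncomputable section

open scoped Classical

universe u

namespace Summit.BirchSwinnertonDyer.BirchSwinnertonDyer.Theorems.AlignedTransportAtTwoFineRoad.RealHalving

open NumberField IsDedekindDomain Field WeierstrassCurve WeierstrassCurve.Affine
open Literature.NumberTheory.EllipticCurves Literature.NumberTheory.EllipticCurves.GreenbergSelmer
open Literature.NumberTheory.GaloisRepresentations
open Summit.BirchSwinnertonDyer.BirchSwinnertonDyer.Theorems.MultTransportAtTwo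
open Summit.BirchSwinnertonDyer.Rank1Residual Summit.BirchSwinnertonDyer.Rank1Residual.X2

/-! ## §1 A real cubic has a real root -/

/-- **The `2`-division cubic has a real root**: for all real `b₂, b₄, b₆` there is `x ∈ ℝ` with
`4x³ + b₂x² + 2b₄x + b₆ = 0` (intermediate value theorem on `[-A, A]`, `A = 1 + |b₂| + |b₄| + |b₆|`).
[folklore] -/
theorem exists_real_root_twoDivisionCubic (b₂ b₄ b₆ : ℝ) :
    ∃ x : ℝ, 4 * x ^ 3 + b₂ * x ^ 2 + 2 * b₄ * x + b₆ = 0 := by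
  set A : ℝ := 1 + |b₂| + |b₄| + |b₆| with hA
  have h2 := abs_nonneg b₂
  have h4 := abs_nonneg b₄
  have h6 := abs_nonneg b₆
  have hA1 : 1 ≤ A := by rw [hA]; linarith
  have hA0 : 0 ≤ A := by linarith
  let g : ℝ → ℝ := fun x ↦ 4 * x ^ 3 + b₂ * x ^ 2 + 2 * b₄ * x + b₆
  have hg : Continuous g := by fun_prop
  have hb₂l : -|b₂| * A ^ 2 ≤ b₂ * A ^ 2 := mul_le_mul_of_nonneg_right (neg_abs_le b₂) (sq_nonneg A)
  have hb₂u : b₂ * A ^ 2 ≤ |b₂| * A ^ 2 := mul_le_mul_of_nonneg_right (le_abs_self b₂) (sq_nonneg A)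
  have hb₄l : -|b₄| * A ≤ b₄ * A := mul_le_mul_of_nonneg_right (neg_abs_le b₄) hA0
  have hb₄u : b₄ * A ≤ |b₄| * A := mul_le_mul_of_nonneg_right (le_abs_self b₄) hA0
  have hb₆l : -|b₆| ≤ b₆ := neg_abs_le b₆
  have hb₆u : b₆ ≤ |b₆| := le_abs_self b₆
  have hc₂ : |b₂| * A ^ 2 ≤ A * A ^ 2 := mul_le_mul_of_nonneg_right (by rw [hA]; linarith) (sq_nonneg A)
  have hc₄ : |b₄| * A ≤ A * A ^ 2 := by
    calc |b₄| * A ≤ A * A := mul_le_mul_of_nonneg_right (by rw [hA]; linarith) hA0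
      _ ≤ A * A ^ 2 := by nlinarith
  have hc₆ : |b₆| ≤ A * A ^ 2 := by
    calc |b₆| ≤ A := by rw [hA]; linarith
      _ ≤ A * A ^ 2 := by nlinarith
  have hpos : 0 ≤ g A := by
    change 0 ≤ 4 * A ^ 3 + b₂ * A ^ 2 + 2 * b₄ * A + b₆
    nlinarith
  have hneg : g (-A) ≤ 0 := by
    change 4 * (-A) ^ 3 + b₂ * (-A) ^ 2 + 2 * b₄ * (-A) + b₆ ≤ 0
    nlinarith
  obtain ⟨x, -, hx⟩ :=
    intermediate_value_Icc (show -A ≤ A by linarith) hg.continuousOn ⟨hneg, hpos⟩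
  exact ⟨x, hx⟩

/-! ## §2 Real halving in `E(ℚ_w)` for `Δ_E > 0`, without a rational `2`-torsion point -/

/-- **Real halving at the infinite place for `Δ_E > 0`.** For an elliptic curve `E/ℚ` with `Δ_E > 0`
and the infinite place `w` (`ℚ_w ≅ ℝ`): there is `e₃ ∈ ℚ_w` with `T₃ = (e₃, −(a₁e₃ + a₃)/2)` a point of
order `2` of `E(ℚ_w)` (the LEAST real root of the `2`-division cubic) such that every `P ∈ E(ℚ_w)` is
`2ᵏQ` or `2ᵏQ + T₃` for every `k`. The cubic has a real root (§1), hence three ordered real roots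
(`exists_ordered_splitTwoTorsion_real`, `Δ > 0`), and over `ℝ` every point is `2ᵏQ` or `2ᵏQ + T₃`
(`exists_pow_smul_eq_or`: `E(ℝ)/2E(ℝ) = ⟨T₃⟩`, Milne *ADT* I Rem. 3.7); transported along
`E(ℚ_w) ≅ E(ℝ)` as in t42's `exists_ordered_splitTwoTorsion_completion` (whose rational `2`-torsion
hypothesis is thereby removed). [cite: MilneADT2006, I Rem. 3.7] [cite: SilvermanAEC2009, Prop. X.1.4] -/
theorem exists_realTwoTorsion_halving (W : WeierstrassCurve ℚ) [W.IsElliptic] (w : InfinitePlace ℚ)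
    (hΔ : 0 < W.Δ) :
    ∃ (e₃ : w.Completion) (h₃ : (W.baseChange w.Completion).toAffine.Nonsingular e₃
        ((W.baseChange w.Completion).toAffine.twoTorsionY e₃)),
      ∀ (k : ℕ) (P : (W.baseChange w.Completion).toAffine.Point),
        ∃ Q : (W.baseChange w.Completion).toAffine.Point,
          (2 ^ k) • Q = P ∨ (2 ^ k) • Q = P + .some e₃ _ h₃ := by
  have hw : w.IsReal := IsTotallyReal.isReal w
  set f : w.Completion ≃+* ℝ := InfinitePlace.Completion.ringEquivRealOfIsReal hw with hf
  have hfq : ∀ q : ℚ, f (q : w.Completion) = (q : ℝ) := fun q ↦ map_ratCast f q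
  -- three ordered real roots, from a real root (IVT) and `Δ > 0`
  obtain ⟨x, hx⟩ := exists_real_root_twoDivisionCubic (W.baseChange ℝ).b₂ (W.baseChange ℝ).b₄
    (W.baseChange ℝ).b₆
  have hΔR : 0 < (W.baseChange ℝ).Δ := by
    rw [WeierstrassCurve.baseChange, WeierstrassCurve.map_Δ, eq_ratCast]; exact_mod_cast hΔ
  obtain ⟨r₁, r₂, r₃, h₂₃, h₁₂, hsplit, -⟩ := exists_ordered_splitTwoTorsion_real (W.baseChange ℝ) hx hΔR
  -- the `b`- and `a`-invariants of `E/ℚ_w` read in `ℝ`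
  have hb₂ : f (W.baseChange w.Completion).b₂ = (W.baseChange ℝ).b₂ := by
    simp only [WeierstrassCurve.baseChange, WeierstrassCurve.map_b₂, eq_ratCast, hfq]
  have hb₄ : f (W.baseChange w.Completion).b₄ = (W.baseChange ℝ).b₄ := by
    simp only [WeierstrassCurve.baseChange, WeierstrassCurve.map_b₄, eq_ratCast, hfq]
  have hb₆ : f (W.baseChange w.Completion).b₆ = (W.baseChange ℝ).b₆ := by
    simp only [WeierstrassCurve.baseChange, WeierstrassCurve.map_b₆, eq_ratCast, hfq]
  have ha₁ : f (W.baseChange w.Completion).a₁ = (W.baseChange ℝ).a₁ := by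
    simp only [WeierstrassCurve.baseChange, WeierstrassCurve.map_a₁, eq_ratCast, hfq]
  have ha₃ : f (W.baseChange w.Completion).a₃ = (W.baseChange ℝ).a₃ := by
    simp only [WeierstrassCurve.baseChange, WeierstrassCurve.map_a₃, eq_ratCast, hfq]
  set e₁ := f.symm r₁ with he₁
  set e₂ := f.symm r₂ with he₂
  set e₃ := f.symm r₃ with he₃
  have hfe₁ : f e₁ = r₁ := f.apply_symm_apply r₁
  have hfe₂ : f e₂ = r₂ := f.apply_symm_apply r₂
  have hfe₃ : f e₃ = r₃ := f.apply_symm_apply r₃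
  have hsplitw : (W.baseChange w.Completion).toAffine.SplitTwoTorsion e₁ e₂ e₃ := by
    refine ⟨f.injective ?_, f.injective ?_, f.injective ?_⟩
    · change f (W.baseChange w.Completion).b₂ = _
      rw [hb₂, hsplit.b₂_eq]; simp [map_ofNat, hfe₁, hfe₂, hfe₃]
    · change f (W.baseChange w.Completion).b₄ = _
      rw [hb₄, hsplit.b₄_eq]; simp [map_ofNat, hfe₁, hfe₂, hfe₃]
    · change f (W.baseChange w.Completion).b₆ = _
      rw [hb₆, hsplit.b₆_eq]; simp [map_ofNat, hfe₁, hfe₂, hfe₃]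
  have h₃ : (W.baseChange w.Completion).toAffine.Nonsingular e₃
      ((W.baseChange w.Completion).toAffine.twoTorsionY e₃) := by
    haveI : CharZero w.Completion :=
      charZero_of_injective_algebraMap (algebraMap ℚ w.Completion).injective
    exact nonsingular_twoTorsion hsplitw.swap₂₃.swap₁₂
  refine ⟨e₃, h₃, ?_⟩
  -- real halving, transported along `E(ℚ_w) ≃ E(ℝ)`
  have hfc : ∀ q : ℚ, f.toRingHom (algebraMap ℚ w.Completion q) = algebraMap ℚ ℝ q := fun q ↦ by
    change f (algebraMap ℚ w.Completion q) = algebraMap ℚ ℝ q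
    rw [eq_ratCast, eq_ratCast, hfq]
  let f' : w.Completion →ₐ[ℚ] ℝ := { f.toRingHom with commutes' := hfc }
  have hf' : ∀ z, f' z = f z := fun _ ↦ rfl
  set φ : (W.baseChange w.Completion).toAffine.Point →+ (W.baseChange ℝ).toAffine.Point :=
    Affine.Point.map f' with hφ
  have hφinj : Function.Injective φ := Affine.Point.map_injective (f := f')
  have hφsurj : Function.Surjective φ := by
    intro Q
    have hgc : ∀ q : ℚ, f.symm.toRingHom (algebraMap ℚ ℝ q) = algebraMap ℚ w.Completion q :=
      fun q ↦ by
        change f.symm (algebraMap ℚ ℝ q) = algebraMap ℚ w.Completion q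
        apply f.injective
        rw [f.apply_symm_apply, eq_ratCast, eq_ratCast, hfq]
    let g' : ℝ →ₐ[ℚ] w.Completion := { f.symm.toRingHom with commutes' := hgc }
    refine ⟨Affine.Point.map g' Q, ?_⟩
    rcases Q with _ | ⟨a, b, hab⟩
    · rfl
    · rw [hφ, Affine.Point.map_some, Affine.Point.map_some]
      simp only [Affine.Point.some.injEq]
      exact ⟨f.apply_symm_apply a, f.apply_symm_apply b⟩
  have h₃R : (W.baseChange ℝ).toAffine.Nonsingular r₃ ((W.baseChange ℝ).toAffine.twoTorsionY r₃) :=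
    nonsingular_twoTorsion hsplit.swap₂₃.swap₁₂
  have hφT : φ (.some e₃ _ h₃) = .some r₃ _ h₃R := by
    rw [hφ, Affine.Point.map_some]
    simp only [Affine.Point.some.injEq]
    refine ⟨by rw [hf', hfe₃], ?_⟩
    rw [hf']
    change f (-((W.baseChange w.Completion).a₁ * e₃ + (W.baseChange w.Completion).a₃) / 2) =
      -((W.baseChange ℝ).a₁ * r₃ + (W.baseChange ℝ).a₃) / 2
    rw [map_div₀, map_neg, map_add, map_mul, ha₁, ha₃, hfe₃, map_ofNat]
  intro k P
  obtain ⟨Q', hQ'⟩ := exists_pow_smul_eq_or hsplit h₁₂ h₂₃ real_pos_isSq k (φ P)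
  obtain ⟨Q, rfl⟩ := hφsurj Q'
  refine ⟨Q, ?_⟩
  rcases hQ' with hQ' | hQ'
  · left; exact hφinj (by rw [map_nsmul]; exact hQ')
  · right
    apply hφinj
    rw [map_nsmul, map_add, hφT]
    convert hQ' using 2

end Summit.BirchSwinnertonDyer.BirchSwinnertonDyer.Theorems.AlignedTransportAtTwoFineRoad.RealHalving

end
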